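import Literature.AlgebraicGeometry.Resolution.WeightedCentrePinTransport
import Literature.AlgebraicGeometry.Resolution.WeightedCentreDerivedFlow
import Literature.AlgebraicGeometry.Resolution.WeightedCentreFaceGraded
import HarnessLib

/-!
# Weighted centres — the honest face of a (P)-menu is a (P)-menu without tailed light flows; the second storey of the tower is injective

Instrument for engine 1's `W(f)` TOY MODEL (cell `pub-rosobs`, LF-MODEL-eng1-g45 §6.2 REDUCTION, storey `≥ 2` of the restriction tower on the honest face ring, following
CARVER-NOTES-eng1-g47 §§2–3), NOT a resolution theorem and NOT about the invariant of [AbramovichTemkinWlodarczyk2024].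

For the bottom class `Z` (every slot of `Z` lighter than every slot outside `Z`): (P) at the slots of weight `≤ p + 1` transports to the face polynomial `killCompl g ∈ k[ε_{¬Z}]`
(`slotPinned_face`, from `SlotPinned.killCompl`), hence THEOREM 𝔉′ holds on the face (`noTailedLightFlow_face`) and THEOREM B's tower storey on the face — `restrictFace` for the
face data `(w ∘ val, Z₂, val ⁻¹' V, killCompl g)` — is injective (`restrictFace_face_injective`): the induction step of the REDUCTION, everything polymorphic in the slot type.

References: [AbramovichTemkinWlodarczyk2024, §5.1 (p. 1575), Thm. 5.3.1 (2)–(3) (p. 1578)]; [Lang2002, Ch. I §3, Ch. IV §1, Ch. XIII §4]; [Matsumura1987, §27].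
-/

namespace Literature.AlgebraicGeometry.Resolution.WeightedBlowup.ZKernel

open Polynomial Truncation TailedLightFlow

variable {k : Type*} [Field k] {ι : Type*} [Fintype ι] [DecidableEq ι] {p : ℕ} {u : ℕ → k} {w : ι → ℚ} {g : MvPolynomial ι k}
  (Z : Set ι) [DecidablePred (· ∈ Z)]

omit [Fintype ι] in
/-- **(P) passes to the honest face of the bottom class**: if every slot of `Z` is lighter than every slot outside `Z`, (P) at the slots of weight `≤ p + 1` of `g` gives (P) at the
slots of weight `≤ p + 1` of the face polynomial `killCompl g` (face weights `w ∘ val`).  [cite: AbramovichTemkinWlodarczyk2024, §5.1 (p. 1575); Lang2002, Ch. XIII §4] -/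
theorem slotPinned_face (hP : ∀ l, w l ≤ (p : ℚ) + 1 → SlotPinned w l g) (hZ : ∀ j ∈ Z, ∀ l ∉ Z, w j < w l)
    (l : {j : ι // j ∉ Z}) (hl : (w ∘ Subtype.val) l ≤ (p : ℚ) + 1) :
    SlotPinned (w ∘ Subtype.val) l (_root_.MvPolynomial.killCompl (Subtype.val_injective (p := fun j : ι => j ∉ Z)) g) :=
  (hP l.1 hl).killCompl w Z (fun j hj => hZ j hj l.1 l.2) l.2

/-- **THEOREM 𝔉′ ON THE FACE**: under `n!·u_n = 1 (n < p)`, `1 < p`, positive weights and (P) at the slots of weight `≤ p + 1`, the honest face `(k[ε_{¬Z}], killCompl g)` of the bottom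
class `Z` carries no tailed light flow (the hypothesis `hN` of THEOREM B / `restrictFace_injective` for the NEXT storey; cf. CARVER-NOTES-eng1-g47 §1: the same-ring face would NOT do).
Instrument for engine 1's `W(f)` toy model, NOT a resolution theorem. [cite: AbramovichTemkinWlodarczyk2024, §5.1 (p. 1575), Thm. 5.3.1 (2)–(3) (p. 1578); Matsumura1987, §27 (pp. 207–209)] -/
theorem noTailedLightFlow_face (hu : ∀ n < p, (Nat.factorial n : k) * u n = 1) (hp : 1 < p) (hw : ∀ i, 0 < w i)
    (hP : ∀ l, w l ≤ (p : ℚ) + 1 → SlotPinned w l g) (hZ : ∀ j ∈ Z, ∀ l ∉ Z, w j < w l) :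
    NoTailedLightFlow p u (w ∘ Subtype.val) (_root_.MvPolynomial.killCompl (Subtype.val_injective (p := fun j : ι => j ∉ Z)) g) :=
  noTailedLightFlow hu hp (fun i => hw i.1) (slotPinned_face Z hP hZ)

/-- **THE SECOND STOREY IS INJECTIVE** (LF-MODEL-eng1-g45 §6.2 REDUCTION, induction step): on the honest face `(k[ε_{¬Z}][σ], w ∘ val, killCompl g)` of the bottom class `Z` of a
(P)-menu with positive weights, the tower storey `restrictFace` for the next light class `Z₂` (weights in `[ζ₂, p)`, `ζ₂ > 0`) and the heavy slots `val ⁻¹' V` is injective — THEOREM B on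
the face, its hypothesis `hN` discharged by `noTailedLightFlow_face`.  Instrument for engine 1's `W(f)` toy model, NOT a resolution theorem.
[cite: Lang2002, Ch. I §3, Ch. IV §1; Matsumura1987, §27 (pp. 207–209); AbramovichTemkinWlodarczyk2024, §5.1 (p. 1575), Thm. 5.3.1 (2)–(3) (p. 1578)] -/
theorem restrictFace_face_injective [Fact p.Prime] [CharP k p] (hu : ∀ n < p, (Nat.factorial n : k) * u n = 1) (hp : 1 < p)
    (hw : ∀ i, 0 < w i) (hP : ∀ l, w l ≤ (p : ℚ) + 1 → SlotPinned w l g) (hZ : ∀ j ∈ Z, ∀ l ∉ Z, w j < w l)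
    {Z₂ : Set {j : ι // j ∉ Z}} {ζ₂ : ℚ} (hZ₂ : ∀ z ∈ Z₂, ζ₂ ≤ (w ∘ Subtype.val) z) (hζ₂ : 0 < ζ₂) (hZ₂p : ∀ z ∈ Z₂, (w ∘ Subtype.val) z < p)
    {V : Set ι} (hVw : ∀ i, w i ≤ (p : ℚ) + 1 ∨ i ∈ V) (hwV : ∀ i ∈ V, (p : ℚ) + 1 < w i) :
    Function.Injective (restrictFace (w ∘ Subtype.val) Z₂ (Subtype.val ⁻¹' V : Set {j : ι // j ∉ Z})
      (_root_.MvPolynomial.killCompl (Subtype.val_injective (p := fun j : ι => j ∉ Z)) g)) := by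
  have hN := noTailedLightFlow_face Z hu hp hw hP hZ
  have hw' : ∀ i : {j : ι // j ∉ Z}, 0 ≤ (w ∘ Subtype.val) i := fun i => (hw i.1).le
  have hVw' : ∀ i : {j : ι // j ∉ Z}, (w ∘ Subtype.val) i ≤ (p : ℚ) + 1 ∨ i ∈ (Subtype.val ⁻¹' V : Set {j : ι // j ∉ Z}) := fun i => hVw i.1
  have hwV' : ∀ i ∈ (Subtype.val ⁻¹' V : Set {j : ι // j ∉ Z}), (p : ℚ) + 1 < (w ∘ Subtype.val) i := fun i hi => hwV i.1 hi
  exact restrictFace_injective p hu hw' hZ₂ hζ₂ hZ₂p hVw' hwV' hN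

end Literature.AlgebraicGeometry.Resolution.WeightedBlowup.ZKernel
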